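import Literature.NumberTheory.EllipticCurves.KuriharaNumberKimShaLength
import Literature.NumberTheory.EllipticCurves.PAdicHeights
import HarnessLib

/-!
# Kim–Nakamura 2020: the Euler-system (UPPER) bound `ord_p #Ш(E)[p^∞] ≤ ord_p(L(E,1)/Ω⁺_E)` in analytic rank `0` at a prime `p` of ADDITIVE reduction — including `p ∈ {3, 5, 7}` outside the "exceptional cases" (named fact)

Topic `NumberTheory/EllipticCurves`, sub-directory `KimNakamura2020` (author–year; namespace = path,
`Literature.NumberTheory.EllipticCurves.KimNakamura2020`). ONE named fact (`def … : Prop`, D-0014),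
weaker than print, plus ONE predicate with a body (`NonExceptional`, the negation of the printed
"exceptional cases", Assumption 2.5) — nothing else. Sibling of
`Literature.NumberTheory.EllipticCurves.Kim2026.rankZero_padicValNat_sha_le_of_maninConstant`
(C.-H. Kim, Amer. J. Math. 148 (2026), Thm. 1.8 (6): the SAME inequality at ANY reduction type but
for `p ≥ 5` only), written in the SAME shape so that the consumers of that fact
(`Summits/BirchSwinnertonDyer/Rank1Residual/Additive/X4RankZeroUpperBound.lean`, seat additive-p4 of
the residual cell `b2b-bsdres`: class X4 = additive `p`, `E[p]` irreducible) port verbatim to the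
prime `p = 3`, which Kim 2026 excludes and where the largest block of the rank-`≤ 1` residue lives.
Written by the cell's Kato-2004 literature seat (lit-kato gen 2).

## The printed statements (C.-H. Kim, K. Nakamura, *Remarks on Kato's Euler systems for elliptic
curves with additive reduction*, J. Number Theory 210 (2020) 249–279, doi:10.1016/j.jnt.2019.09.011
= arXiv:1808.07726; held text = the arXiv version, store key `paper:arxiv-1808.07726`, whose page
files `pNNNN.txt` are cited with line numbers)

* Standing (p0003 L13–14): "Let `p` be an odd prime and `E` be an elliptic curve of conductor `N`
  over `ℚ`. Throughout this article, we assume that `E` has additive reduction at `p`. In other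
  words, `p²` divides `N`."
* **Assumption 1.1 (Working assumptions)** (p0003 L33–37), verbatim: "(1) `p` does not divide
  `Tam(E) · ∏_{ℓ ∣ N_st}(ℓ − 1) · ∏_{ℓ ∣ N_ns}(ℓ + 1)` [`Tam(E)` the Tamagawa number of `E`, `N_st`,
  `N_ns` the products of the split / non-split multiplicative reduction primes of `E`]. (2) The mod
  `p` Galois representation `ρ̄ : G_ℚ → Aut_{𝔽_p}(E[p])` is surjective. (Thus, `E` is non-CM.)
  (3) The Manin constant is prime to `p`. (It is expected to be true always.)"; modular symbols
  `2π ∫₀^∞ f(a/b + iy) dy = [a/b]⁺ Ω⁺_E + [a/b]⁻ Ω⁻_E` "where `Ω^±_E` are the Néron periods of `E`"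
  (p0003 L40–44).
* **Theorem 1.7 (The `p`-part of BSD formula)** (p0004 L20–31), verbatim: "Let `E` be an elliptic
  curve with additive reduction at `p > 7` satisfying Assumption 1.1. Suppose that `L(E,1) ≠ 0`. If
  `δ̃_n ≠ 0 ∈ 𝔽_p` for some square-free product of Kolyvagin primes `n`, then the `p`-part of Birch
  and Swinnerton-Dyer formula for `E` holds, i.e. `ord_p(#Ш(E/ℚ)[p^∞]) = ord_p(L(E,1)/Ω⁺_E)`."
* **Remark 1.8** (p0004 L33–41): "(1) Even in the `p ≤ 7` case, Theorem 1.6 and Theorem 1.7 hold if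
  `(E,p)` does not satisfy Assumption 2.5. … (4) If we replace `L(E,1)` by the `N`-imprimitive
  `L`-value `L^{(N)}(E,1)` in Theorem 1.7, then we can weaken Assumption 1.1.(1) by `p ∤ Tam(E)`."
* The model (p0005 L15–19): "Let `𝓔` be a minimal Weierstrass model of `E` over `ℤ_p` given by a
  Weierstrass equation `y² + a₁xy + a₃y = x³ + a₂x² + a₄x + a₆` where `a_i ∈ pℤ_p` for each `i`. By
  the coordinate change, it is not difficult to see that such a minimal Weierstrass model always
  exists." **Assumption 2.5 (Exceptional cases)** (p0005 L93–104): "Following the notation of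
  Equation (2.1), if one of the following conditions `p = 2` and `a₁ + a₃ ≡ 2 (mod 4)`, `p = 3` and
  `a₂ ≡ 6 (mod 9)`, `p = 5` and `a₄ ≡ 10 (mod 25)`, or `p = 7` and `a₆ ≡ 14 (mod 49)`, holds, then we
  call it an exceptional case." (p0006 L1–3: "In the exceptional cases, `E₀(K)` admits non-trivial
  `p`-torsions … [pannekoek], [kosters-pannekoek]. We do not consider the exceptional cases".)
* **Theorem 2.1** ([pannekoek], [kosters-pannekoek]; p0005 L36–40): "Let `E/ℚ_p` be an elliptic
  curve with additive reduction and `K/ℚ_p` be a finite unramified extension. Then the extension of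
  the formal logarithm map on `E` induces an isomorphism `log_E : E₀(K) ⊗ ℤ_p ≅ 𝓞_K` if `(E,p)`
  does not satisfy Assumption 2.5." **Proposition 2.2** (p0005 L43–51; the case `p = 3` is treated
  explicitly, via [silverman2]): "`p` does not divide `[E(K) : E₀(K)]`". **Corollary 2.4** (p0005
  L76–78): "The image of `H¹(K,T)/H¹_f(K,T)` under `exp*` is `𝓞_K ω_E` where `H¹_f(K,T)` is the
  image of the Kummer map of `E(K) ⊗ ℤ_p`" (`ω_E` a Néron differential; under (3) it "corresponds to
  `f(z)dz` up to a `p`-adic unit via the modular parametrization", p0005 L59–61).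
* **Theorem 3.1** (p0007 L13–22; Kato's explicit reciprocity law for an ADDITIVE `p`, the Euler
  factor at `p` being `1`, p0007 L4): for Kato's Euler system `c_{ℚ(μ_n)}(1)` normalised by
  `exp*(c_ℚ(1)) = L^{(Np)}(E,1)/Ω⁺_E · ω_E` (p0007 L9), the twisted interpolation with the factors
  `∏_{q ∣ N_sp}(1 − q⁻¹χ(q)) · ∏_{q ∣ N_ns}(1 + q⁻¹χ(q)) · L^{(p)}(E,χ,1)/Ω^{χ(−1)}_E`.
* **Theorem 4.2** (p0009 L29–37): "Suppose that `p > 2` and `T` satisfies `Hyp(ℚ,T)` [Assumption 4.1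
  = Rubin, *Euler Systems*: `∃ τ ∈ G_ℚ` trivial on `μ_{p^∞}` with `T/(τ−1)T` free of rank one, and `ρ̄`
  irreducible]. Let `c` be an Euler system for `T` and `κ` the corresponding Kolyvagin system with
  `c_ℚ(1) = z₁`. Assume that `loc^s_p(z₁) ≠ 0`. … (2) `length_{ℤ_p}(Sel_str(ℚ,E[p^∞])) ≤ ∂^{(0)}(κ)
  := max{j : z₁ ∈ p^j Sel_rel(ℚ,T)}`. (3) If `κ` is primitive, then [equality]." (Proof: "See
  [rubin-book] and [mazur-rubin-book]"; before it, p0009 L22–25: "By [rubin-book], if the `p`-adic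
  representation `ρ : G_ℚ → Aut_{ℤ_p}(T)` is surjective, then `H¹(ℚ(W)/ℚ, E[p^∞]) ≅
  H¹(GL₂(ℤ_p), (ℚ_p/ℤ_p)²) = 0`, so [the error terms vanish]. Furthermore, if `ρ̄` is surjective
  with `p > 3`, then `ρ` is surjective".) The exact sequence (4.3) (p0009 L70–76):
  `0 → Sel_rel(ℚ,T)/ℤ_p c_ℚ(1) → H¹_s(ℚ_p,T)/ℤ_p loc^s_p c_ℚ(1) → Sel(ℚ,E[p^∞])^∨ → Sel_str(ℚ,E[p^∞])^∨ → 0`,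
  `H¹_s(ℚ_p,T) = H¹(ℚ_p,T)/E(ℚ_p) ⊗ ℤ_p`. **Theorem 4.4** (p0009 L84–90; "`p > 2` and `Hyp(ℚ,T)` …
  `loc^s_p(z₁) ≠ 0` and `κ` primitive. Then `Sel(ℚ,E[p^∞])` is finite and `length = length
  H¹_s(ℚ_p,T)/loc^s_p(z₁)`"). **Theorem 4.5** (p0009 L108–p0010 L8; "odd prime `p > 7` … `L(E,1) ≠ 0`,
  `ρ̄` surjective, `p ∤ Tam(E)` and `κ` primitive ⟹ `ord_p #Ш(E/ℚ)[p^∞] = ord_p(L(E,1)/Ω⁺_E)`";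
  proof: "By Corollary 2.4, `⟨ω*_E, exp*(H¹_s(ℚ_p,T))⟩ = ℤ_p`, `⟨ω*_E, exp*(ℤ_p loc^s_p z₁)⟩ =
  (L(E,1)/Ω⁺_E) ℤ_p` … the finiteness of `Sel(ℚ,E[p^∞])` and the surjectivity of `ρ̄` show that
  `#Sel(ℚ,E[p^∞]) = #Ш(E/ℚ)[p^∞]`. By Theorem 4.4 …").
* **§6.3, the `N`-imprimitive Euler system (PRINTED; the content of Rem. 1.8 (4)).** Def. 6.20 (p0015
  L110–114): "Due to Lemma 6.16 with Remark 6.17, the Euler system in §3.1 can be chosen by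
  `c_{ℚ(μ_m)}(1) := z^{(Np)}_{γ,m}(1)` where `f` is the modular form corresponding to `E`, `k = 2`,
  `j₁ = j₂ = 1`"; p0015 L69–77: "`z^{(Np)}_{γ,m}(k−r)` obviously forms an integral Euler system and
  interpolates `Np`-imprimitive `L`-values of `f` at `s = r` twisted by finite order characters";
  Lemma 6.16 (p0015 L15–36; Assumption `(**)`: "`j = k−1`, `k < p`, and `r ≠ 2`") with Rem. 6.17 (p0015
  L38–39): "If `k = 2`, Assumption `(**)` … is automatic" (so no hidden `p ≥ 5`: at `p = 3`, `k = 2 < 3`);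
  Lemma 6.21 and its proof (p0016 L9–22): "Under Assumption 1.1.(1), `char_Λ(ℍ¹(T)/Λz^{(N)}_Kato) =
  char_Λ(ℍ¹(T)/Λz_Kato)`", with `z^{(N)}_Kato = ∏_{ℓ ∣ N_st}(1 − ℓ⁻¹σ_ℓ⁻¹)·∏_{ℓ ∣ N_ns}(1 + ℓ⁻¹σ_ℓ⁻¹)·z_Kato`,
  the product being "invertible in `Λ`" exactly under the `(ℓ ∓ 1)`-clause of Assumption 1.1 (1); its
  `χ = 1` specialisation is the defect `Σ_{ℓ ∣ N_st} ord_p(ℓ − 1) + Σ_{ℓ ∣ N_ns} ord_p(ℓ + 1)` of the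
  second fact below.

## The fact below (weaker than print) and its one-paragraph derivation from the printed statements

THE INEQUALITY. Drop the primitivity / Kurihara-number hypothesis of Thms 4.4–4.5 / 1.7 and keep
everything else. By (4.3), `length Sel(ℚ,E[p^∞]) = length Sel_str(ℚ,E[p^∞]) +
length(H¹_s(ℚ_p,T)/ℤ_p loc^s_p z₁) − length(loc^s_p(Sel_rel(ℚ,T))/ℤ_p loc^s_p z₁)`, and Thm 4.2 (2)
with the first display of the proof of Thm 4.4 (`∂^{(0)}(κ) = length(loc^s_p(Sel_rel(ℚ,T))/ℤ_p loc^s_p z₁)`)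
gives `length Sel_str ≤` the subtracted term; hence `length Sel(ℚ,E[p^∞]) ≤ length(H¹_s(ℚ_p,T)/ℤ_p loc^s_p z₁)`,
which the proof of Thm 4.5 (Cor 2.4 + Thm 3.1 + Assumption 1.1 (1), so that the factors
`(1 ∓ q⁻¹)` at the multiplicative `q` are `p`-units) evaluates as `ord_p(L(E,1)/Ω⁺_E)`; and
`#Sel(ℚ,E[p^∞]) = #Ш(E/ℚ)[p^∞]` (`L(E,1) ≠ 0`, `ρ̄` onto). So, under the hypotheses of Thm 1.7
WITHOUT the Kurihara number: `ord_p #Ш(E/ℚ)[p^∞] ≤ ord_p(L(E,1)/Ω⁺_E)` — for `p > 7`, and, by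
Remark 1.8 (1), for `p ∈ {3, 5, 7}` when `(E,p)` is not exceptional (Assumption 2.5). (The EQUALITY of
Thm 1.7 needs in addition a unit Kurihara number and the primitivity theory of Mazur–Rubin, whose
hypothesis (H.4) reads `p > 4` for `T = T_pE`; it is NOT vendored here, and at `p = 3` it should not be.)

HYPOTHESES AS TYPED (each at least as strong as the printed one — the fact is weaker than print,
never stronger): `p` odd; ADDITIVE reduction at `p` (neither good nor multiplicative); `7 < p`, or
`NonExceptional W p` below; the image hypothesis is typed as **`ρ̄_{E,p^n}` onto for every `n`**
(`p`-ADIC surjectivity) — stronger than the printed "(2) `ρ̄` surjective", and exactly what the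
printed proof uses (p0009 L22–25: the vanishing of the error terms and `Hyp(ℚ,T)` need `ρ`
surjective; "if `ρ̄` is surjective with `p > 3`, then `ρ` is surjective"; at `p = 3` the `3`-adic
statement is supplied by `surj(9)` through the tree theorem
`WeierstrassCurve.forall_hasSurjectiveModNGaloisRep_three_pow_of_nine`, Serre's lifting lemma one
level up); Assumption 1.1 (1) verbatim (`p ∤ ∏_ℓ c_ℓ`, and `p ∤ ℓ − 1`, resp. `p ∤ ℓ + 1`, at every
split, resp. non-split, multiplicative prime `ℓ`); Assumption 1.1 (3) carried EXPLICITLY by a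
modular parametrisation datum `D` with `p ∤ c_D`, exactly as in the Kim 2026 sibling;
`L(E,1) ≠ 0`; and `Ш(E/ℚ)` finite (a consequence in the paper — rank `0`, Rubin — kept as a
hypothesis, weaker fact). CONCLUSION, in the sibling's shape: there is `q ∈ ℚ` with
`L(E,1)/Ω(W) = q` and `ord_p #Ш(E/ℚ)(p) ≤ ord_p q`. NORMALISATIONS: `Ω⁺_E` "the Néron period" is
the tree's `W.realPeriodRat` (global minimal model, `E(ℝ)` with its components) up to the factor
`#π₀(E(ℝ)) ∈ {1, 2}`, invisible to `ord_p` for odd `p`; `Tam(E) = ∏_ℓ c_ℓ` is `W.tamagawaProduct`.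
No `_holds` (size XL: Kato's Euler system, Rubin's Euler-system bound, Kosters–Pannekoek's formal-group
analysis). Flags for the cell referee: `KN20-p≤7-by-Remark-1.8(1)` (the `p ∈ {3,5,7}` range rests on a
printed Remark, whose ingredients Thm 2.1 / Prop 2.2 / Thm 3.1 / Thm 4.2 / (4.3) are however all
stated for odd `p`), `KN20-inequality-packaging` (inequality extracted from Thm 4.2 (2) + (4.3) + the
proof of Thm 4.5, as displayed above).

## References

* C.-H. Kim, K. Nakamura, J. Number Theory 210 (2020) 249–279 = arXiv:1808.07726: Assumption 1.1,
  Thm. 1.7, Rem. 1.8 (1)(4), (2.1), Thm. 2.1, Prop. 2.2, Cor. 2.4, Assumption 2.5, Thm. 3.1, Thm. 4.2,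
  (4.3), Thm. 4.4, Thm. 4.5; §6.3: Def. 6.20, Lemma 6.16 with Rem. 6.17 (arXiv p. 15), Lemma 6.21 and
  its proof (arXiv p. 16) — the `N`-imprimitive Euler system behind Rem. 1.8 (4). [KimNakamura2020]
* K. Rubin, *Euler Systems*, Annals of Math. Studies 147 (2000), Thm. 2.2.2 (`p > 2`), §3.5. [Rubin2000]
* K. Kato, Astérisque 295 (2004), Thm. 12.5 (4) (p. 222: integrality of the zeta elements for `p ≠ 2`
  under (12.5.2)). [Kato2004Asterisque]
* M. Kosters, R. Pannekoek, *On the structure of elliptic curves over finite extensions of `ℚ_p` with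
  additive reduction*, arXiv:1703.07888 (2017), Thm. 1 and **Cor. 2** (store `paper:arxiv-1703.07888`
  p0003 L37–56, verbatim: "Let `E/ℚ_p` be an elliptic curve given by a Weierstrass equation over `ℤ_p`
  … with `a_i ∈ pℤ_p` for each `i`. One has `E₀(ℚ_p) ≅_{ℤ_p} ℤ_p`, unless one is in one of the four
  special cases: (i) `p = 2` and `a₁ + a₃ ≡ 2 (mod 4)`; (ii) `p = 3` and `a₂ ≡ 6 (mod 9)`; (iii) `p = 5`
  and `a₄ ≡ 10 (mod 25)`; (iv) `p = 7` and `a₆ ≡ 14 (mod 49)`. In all special cases one has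
  `E₀(ℚ_p) ≅_{ℤ_p} ℤ_p × ℤ/pℤ`." — so, for a MINIMAL such model, being exceptional is the intrinsic
  property "`E₀(ℚ_p)` has `p`-torsion", independent of the model); R. Pannekoek, *On `p`-torsion of
  `p`-adic elliptic curves with additive reduction*, arXiv:1211.5833 (2012).
* C.-H. Kim, Amer. J. Math. 148 (2026) 79–129, Thm. 1.8 (the sibling fact, `p ≥ 5`). [Kim2022StructureSelmer]
-/

noncomputable section

open scoped Classical

open Literature.NumberTheory.EllipticCurves.ModularForms

namespace Literature.NumberTheory.EllipticCurves.KimNakamura2020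

/-- **NOT an "exceptional case" (Kim–Nakamura 2020, Assumption 2.5; Pannekoek, Kosters–Pannekoek).**
For a GLOBALLY MINIMAL `W/ℚ` with additive reduction at `p`: there is a translate `C • W` with
`u_C = 1` (so the same discriminant — still minimal at `p` — and, the new coefficients being
integers, a minimal Weierstrass model over `ℤ_p`) whose coefficients are all divisible by `p`,
`a_i = p b_i` ("`a_i ∈ pℤ_p` for each `i`", KN20 (2.1), p0005 L15–19), and which does NOT satisfy
the printed congruence: `p = 2` and `a₁ + a₃ ≡ 2 (mod 4)`; `p = 3` and `a₂ ≡ 6 (mod 9)`; `p = 5` and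
`a₄ ≡ 10 (mod 25)`; `p = 7` and `a₆ ≡ 14 (mod 49)` (KN20 Assumption 2.5, p0005 L93–104; for
`a_i = p b_i` these read `b₁ + b₃ ≡ 1 (mod 2)`, `b₂ ≡ 2 (mod 3)`, `b₄ ≡ 2 (mod 5)`, `b₆ ≡ 2 (mod 7)`).
For `p ∉ {2,3,5,7}` the congruence clauses are vacuous (and the fact below does not use the
predicate there). Model-independence (not used by the fact): by Kosters–Pannekoek, Cor. 2, for a
`p`-MINIMAL model with `p ∣ a_i` the congruence holds iff `E₀(ℚ_p)` has `p`-torsion — a property of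
`E/ℚ_p` — so "there is such a model" and "every such model" agree (for `p = 3` also elementarily: a
change of variables between two such models has `r ≡ s ≡ t ≡ 0 (mod 3)`, `u ∈ ℤ₃ˣ`, so
`u²a₂' ≡ a₂ (mod 9)` and `6u⁻² ≡ 6 (mod 9)`).
[cite: KimNakamura2020, Assumption 2.5 with (2.1) (arXiv p. 5)] [cite: KostersPannekoek2017, Cor. 2] -/
def NonExceptional (W : WeierstrassCurve ℚ) (p : ℕ) : Prop :=
  ∃ C : WeierstrassCurve.VariableChange ℚ, C.u = 1 ∧
    ∃ b₁ b₂ b₃ b₄ b₆ : ℤ,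
      (C • W).a₁ = (p : ℚ) * b₁ ∧ (C • W).a₂ = (p : ℚ) * b₂ ∧ (C • W).a₃ = (p : ℚ) * b₃ ∧
        (C • W).a₄ = (p : ℚ) * b₄ ∧ (C • W).a₆ = (p : ℚ) * b₆ ∧
      (p = 2 → ¬ (2 : ℤ) ∣ b₁ + b₃ - 1) ∧ (p = 3 → ¬ (3 : ℤ) ∣ b₂ - 2) ∧
        (p = 5 → ¬ (5 : ℤ) ∣ b₄ - 2) ∧ (p = 7 → ¬ (7 : ℤ) ∣ b₆ - 2)

/-- Unfolding `NonExceptional` at `p = 3`: only the `a₂`-clause is live. [cite: KimNakamura2020, Assumption 2.5 (arXiv p. 5)] -/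
theorem nonExceptional_three_iff (W : WeierstrassCurve ℚ) :
    NonExceptional W 3 ↔
      ∃ C : WeierstrassCurve.VariableChange ℚ, C.u = 1 ∧
        ∃ b₁ b₂ b₃ b₄ b₆ : ℤ,
          (C • W).a₁ = (3 : ℚ) * b₁ ∧ (C • W).a₂ = (3 : ℚ) * b₂ ∧ (C • W).a₃ = (3 : ℚ) * b₃ ∧
            (C • W).a₄ = (3 : ℚ) * b₄ ∧ (C • W).a₆ = (3 : ℚ) * b₆ ∧ ¬ (3 : ℤ) ∣ b₂ - 2 := by
  unfold NonExceptional
  rw [Nat.cast_ofNat]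
  constructor
  · rintro ⟨C, hu, b₁, b₂, b₃, b₄, b₆, h₁, h₂, h₃, h₄, h₆, -, h3, -, -⟩
    exact ⟨C, hu, b₁, b₂, b₃, b₄, b₆, h₁, h₂, h₃, h₄, h₆, h3 rfl⟩
  · rintro ⟨C, hu, b₁, b₂, b₃, b₄, b₆, h₁, h₂, h₃, h₄, h₆, h3⟩
    exact ⟨C, hu, b₁, b₂, b₃, b₄, b₆, h₁, h₂, h₃, h₄, h₆, fun h => absurd h (by norm_num),
      fun _ => h3, fun h => absurd h (by norm_num), fun h => absurd h (by norm_num)⟩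

/-- **Certificate constructor for `NonExceptional W 3`.**  To certify that `(E,3)` is not a
Kosters–Pannekoek exceptional case it suffices to exhibit a translation `(r, s, t)` (with `u = 1`) and
integers `bᵢ` such that the translated coefficients — Mathlib's `variableChange_aᵢ` formulas,
`a₁' = a₁ + 2s`, `a₂' = a₂ − s a₁ + 3r − s²`, `a₃' = a₃ + r a₁ + 2t`,
`a₄' = a₄ − s a₃ + 2r a₂ − (t + rs) a₁ + 3r² − 2st`, `a₆' = a₆ + r a₄ + r² a₂ + r³ − t a₃ − t² − rt a₁` —
are `3 bᵢ` with `b₂ ≢ 2 (mod 3)` (i.e. `a₂' ≢ 6 (mod 9)`); each hypothesis is a closed rational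
identity, decidable by `norm_num` on a concrete curve. [cite: KimNakamura2020, Assumption 2.5 with (2.1) (arXiv p. 5)]
[cite: KostersPannekoek2017, Cor. 2] -/
theorem nonExceptional_three_of_translate (W : WeierstrassCurve ℚ) (r s t : ℚ) (b₁ b₂ b₃ b₄ b₆ : ℤ)
    (h₁ : W.a₁ + 2 * s = 3 * b₁)
    (h₂ : W.a₂ - s * W.a₁ + 3 * r - s ^ 2 = 3 * b₂)
    (h₃ : W.a₃ + r * W.a₁ + 2 * t = 3 * b₃)
    (h₄ : W.a₄ - s * W.a₃ + 2 * r * W.a₂ - (t + r * s) * W.a₁ + 3 * r ^ 2 - 2 * s * t = 3 * b₄)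
    (h₆ : W.a₆ + r * W.a₄ + r ^ 2 * W.a₂ + r ^ 3 - t * W.a₃ - t ^ 2 - r * t * W.a₁ = 3 * b₆)
    (hb : ¬ (3 : ℤ) ∣ b₂ - 2) : NonExceptional W 3 := by
  rw [nonExceptional_three_iff]
  refine ⟨⟨1, r, s, t⟩, rfl, b₁, b₂, b₃, b₄, b₆, ?_, ?_, ?_, ?_, ?_, hb⟩
  · rw [WeierstrassCurve.variableChange_a₁, ← h₁]; simp
  · rw [WeierstrassCurve.variableChange_a₂, ← h₂]; simp
  · rw [WeierstrassCurve.variableChange_a₃, ← h₃]; simp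
  · rw [WeierstrassCurve.variableChange_a₄, ← h₄]; simp
  · rw [WeierstrassCurve.variableChange_a₆, ← h₆]; simp

/-- **Kim–Nakamura 2020, Thm. 1.7 with Rem. 1.8 (1), INEQUALITY form (Thm. 4.2 (2) + (4.3) + Cor.
2.4 + Thm. 3.1, as in the proof of Thm. 4.5), analytic rank `0`, ADDITIVE `p`, any odd `p` outside
the exceptional cases** (J. Number Theory 210 (2020) 249–279 = arXiv:1808.07726; see the module
docstring for the verbatim statements, locators and the derivation).  Let `W/ℚ` be a globally
minimal elliptic curve and `p` an odd prime of ADDITIVE reduction (`p² ∣ N`); assume `p > 7` or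
that `(E,p)` is not exceptional (Assumption 2.5); assume `ρ̄_{E,p^n}` onto for every `n` (the
printed hypothesis is `ρ̄_{E,p}` onto, the printed proof uses `ρ_{E,p}` onto — typed in the stronger,
`p`-adic form, so valid at `p = 3` too); Assumption 1.1 (1): `p ∤ ∏_ℓ c_ℓ`, `p ∤ ℓ − 1` at every
split and `p ∤ ℓ + 1` at every non-split multiplicative prime `ℓ`; Assumption 1.1 (3) via a modular
parametrisation datum `D` with Manin constant prime to `p`; `L(E,1) ≠ 0`; `Ш(E/ℚ)` finite. Then
`ord_p #Ш(E/ℚ)[p^∞] ≤ ord_p(L(E,1)/Ω⁺_E)`: there is `q ∈ ℚ` with `L(E,1)/Ω(W) = q` and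
`ord_p #Ш(E/ℚ)(p) ≤ ord_p q`. Weaker than print (inequality; stronger image hypothesis; `Finite Ш`
assumed), never stronger. No `_holds` (size XL). Shape identical to the sibling
`Kim2026.rankZero_padicValNat_sha_le_of_maninConstant` (`p ≥ 5`, any reduction).
[cite: KimNakamura2020, Thm. 1.7 and Rem. 1.8 (1) (arXiv p. 4); Thm. 4.2 (2), (4.3), Thm. 4.4, Thm. 4.5 (arXiv pp. 9–10); Cor. 2.4, Prop. 2.2, Thm. 2.1, Assumption 2.5 (arXiv p. 5); Thm. 3.1 (arXiv p. 7); Assumption 1.1 (arXiv p. 3)]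
[cite: Rubin2000, Thm. 2.2.2] [cite: Kato2004Asterisque, Thm. 12.5 (4) (p. 222)] -/
def rankZero_padicValNat_sha_le_of_maninConstant : Prop :=
  ∀ (W : WeierstrassCurve ℚ) [W.IsElliptic] [W.IsGloballyMinimal] (p : ℕ) [Fact p.Prime],
    p ≠ 2 →
    ¬ W.HasGoodReductionAtPrime p → ¬ W.HasMultiplicativeReductionAtPrime p →
    (7 < p ∨ NonExceptional W p) →
    (∀ n : ℕ, W.HasSurjectiveModNGaloisRep (p ^ n : ℕ)) →
    ¬ p ∣ W.tamagawaProduct →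
    (∀ (ℓ : ℕ) [Fact ℓ.Prime], W.HasMultiplicativeReductionAtPrime ℓ →
      (W.HasSplitMultiplicativeReductionAtPrime ℓ → ¬ p ∣ ℓ - 1) ∧
        (¬ W.HasSplitMultiplicativeReductionAtPrime ℓ → ¬ p ∣ ℓ + 1)) →
    W.entireLFunction 1 ≠ 0 → Finite W.sha →
    ∀ {N : ℕ} [NeZero N] (D : ModularParametrizationData W N),
    ¬ (p : ℤ) ∣ D.maninConstant →
    ∃ q : ℚ, W.entireLFunction 1 / (W.realPeriodRat : ℂ) = (q : ℂ) ∧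
      (padicValNat p (Nat.card (AddCommGroup.primaryComponent W.sha p)) : ℤ) ≤ padicValRat p q

/-- **Kim–Nakamura 2020, Thm. 1.7 with Rem. 1.8 (1) AND Rem. 1.8 (4): the `N`-IMPRIMITIVE form of
the rank-`0` Euler-system inequality at an ADDITIVE odd `p`** — the SAME reading as
`rankZero_padicValNat_sha_le_of_maninConstant` above (Thm. 4.2 (2) + (4.3) + Cor. 2.4 + Thm. 3.1,
as in the proof of Thm. 4.5), but WITHOUT the clause "`p ∤ ∏_{ℓ ∣ N_st}(ℓ − 1) · ∏_{ℓ ∣ N_ns}(ℓ + 1)`"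
of Assumption 1.1 (1), at the price of the `N`-imprimitive `L`-value in the bound. Printed
(J. Number Theory 210 (2020) 249–279 = arXiv:1808.07726, Rem. 1.8 (4), arXiv p. 4): "If we replace
`L(E,1)` by the `N`-imprimitive `L`-value `L^{(N)}(E,1)` in Theorem 1.7, then we can weaken
Assumption 1.1.(1) by `p ∤ Tam(E)`. (c.f. [mazur-rubin-book].)"; Rem. 1.8 (1) (same page): "Even in
the `p ≤ 7` case, Theorem 1.6 and Theorem 1.7 hold if `(E,p)` does not satisfy Assumption 2.5."
WHY THE BOUND READS AS TYPED: §3 standing sentence (arXiv p. 7): "Let `E` be an elliptic curve over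
`ℚ` with additive reduction at `p`; especially, the Euler factor at `p` of `L`-function `L(E,s)` is
`1`", and §3.1 (p. 7): Kato's Euler system is normalised by "`exp*(c_ℚ(1)) = L^{(Np)}(E,1)/Ω⁺_E ω_E`
where `L^{(Np)}(E,χ,1)` is the `Np`-imprimitive `L`-value"; Thm. 3.1 at the trivial character spells
the imprimitive factors: "`(∏_{q ∣ N_sp}(1 − q⁻¹χ(q))) · (∏_{q ∣ N_ns}(1 + q⁻¹χ(q))) · L^{(p)}(E,χ,1)/Ω`"
(`N_sp`, `N_ns` = the split / non-split multiplicative primes; the additive primes `q ≠ p` have Euler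
factor `1`); and the `N`-imprimitive Euler system itself is PRINTED in §6.3 — Def. 6.20 (arXiv p. 15:
`c_{ℚ(μ_m)}(1) := z^{(Np)}_{γ,m}(1)`, "an integral Euler system [which] interpolates `Np`-imprimitive
`L`-values", by Lemma 6.16 with Rem. 6.17, Assumption `(**)` being automatic for `k = 2`) and Lemma 6.21
with its proof (arXiv p. 16: `z^{(N)}_Kato = ∏_{ℓ ∣ N_st}(1 − ℓ⁻¹σ_ℓ⁻¹)·∏_{ℓ ∣ N_ns}(1 + ℓ⁻¹σ_ℓ⁻¹)·z_Kato`,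
the product being a unit of `Λ` exactly under the `(ℓ ∓ 1)`-clause of Assumption 1.1 (1)), whose `χ = 1`
specialisation is the defect below. Hence, by the inequality of Thm. 4.2 (2) with (4.3) and Cor. 2.4 exactly as in the proof
of Thm. 4.5 (arXiv pp. 9–10: "`⟨ω*_E, exp*(H¹_s(ℚ_p,T))⟩ = ℤ_p`", "`length Sel(ℚ,E[p^∞]) = length
H¹_s(ℚ_p,T)/loc^s_p(z₁)`", "`#Sel(ℚ,E[p^∞]) = #Ш(E/ℚ)[p^∞]`"):
`ord_p #Ш(E/ℚ)[p^∞] ≤ ord_p(L^{(N)}(E,1)/Ω⁺_E) = ord_p(L(E,1)/Ω⁺_E) + Σ_{ℓ ∣ N_sp} ord_p(ℓ − 1) +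
Σ_{ℓ ∣ N_ns} ord_p(ℓ + 1)` (the multiplicative `ℓ` are `≠ p`, `p` being additive, so `ord_p ℓ = 0`).
TYPED (weaker than print, never stronger): all hypotheses of the sibling fact VERBATIM except the
`(ℓ ∓ 1)`-clause, which is DROPPED; the defect is carried by an arbitrary finite set `S ⊂ ℕ`
containing every multiplicative prime of `E` and an arbitrary function `d : ℕ → ℕ` bounding the
printed local terms (`ord_p(ℓ − 1) ≤ d ℓ` at split `ℓ`, `ord_p(ℓ + 1) ≤ d ℓ` at non-split `ℓ`), so
that `Σ_{ℓ ∈ S} d ℓ ≥ Σ_{ℓ ∣ N_sp} ord_p(ℓ − 1) + Σ_{ℓ ∣ N_ns} ord_p(ℓ + 1)`; conclusion: there is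
`q ∈ ℚ` with `L(E,1)/Ω(W) = q` and `ord_p #Ш(E/ℚ)(p) ≤ ord_p q + Σ_{ℓ ∈ S} d ℓ`. With `d ≡ 0` this is
exactly the sibling fact (the `(ℓ ∓ 1)`-clause reappears as `ord_p(ℓ ∓ 1) ≤ 0`). The Tamagawa binder
`p ∤ Tam(E)` is KEPT, as Rem. 1.8 (4) keeps it — and it is load-bearing at `p = 3`: it supplies the
conclusion of Prop. 2.2 (`p ∤ [E(ℚ_p) : E₀(ℚ_p)] = c_p`, which can fail at `p = 3` on Kodaira types
IV / IV*, where `c_3 = 3` occurs) used by Cor. 2.4, so it must not be "simplified" away; the image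
hypothesis is typed `p`-adically
(`ρ̄_{E,p^n}` onto for every `n`) as in the sibling; `Finite Ш` and `L(E,1) ≠ 0` as in the sibling.
No `_holds` (size XL). Flags for the cell referee (proposed): `KN20-p≤7-by-Remark-1.8(1)`,
`KN20-inequality-packaging` (as the sibling) and `KN20-imprimitive-by-Remark-1.8(4)` (the
`N`-imprimitive weakening is a printed Remark; its content is the §3.1 normalisation
`exp*(c_ℚ(1)) = L^{(Np)}(E,1)/Ω⁺_E · ω_E` read through the same Thm. 4.2 (2) + (4.3) + Cor. 2.4).
[cite: KimNakamura2020, Rem. 1.8 (4) and Rem. 1.8 (1) with Thm. 1.7 (arXiv p. 4); §3 and §3.1 with Thm. 3.1 (arXiv p. 7); Thm. 4.2 (2), (4.3), Thm. 4.4, Thm. 4.5 and its proof (arXiv pp. 9–10); Cor. 2.4, Prop. 2.2, Thm. 2.1, Assumption 2.5 (arXiv p. 5); Assumption 1.1 (arXiv p. 3); §6.3: Def. 6.20, Lemma 6.16 with Rem. 6.17 (arXiv p. 15), Lemma 6.21 and its proof (arXiv p. 16)]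
[cite: Rubin2000, Thm. 2.2.2] [cite: Kato2004Asterisque, Thm. 12.5 (4) (p. 222)] -/
def rankZero_padicValNat_sha_le_imprimitive_of_maninConstant : Prop :=
  ∀ (W : WeierstrassCurve ℚ) [W.IsElliptic] [W.IsGloballyMinimal] (p : ℕ) [Fact p.Prime],
    p ≠ 2 →
    ¬ W.HasGoodReductionAtPrime p → ¬ W.HasMultiplicativeReductionAtPrime p →
    (7 < p ∨ NonExceptional W p) →
    (∀ n : ℕ, W.HasSurjectiveModNGaloisRep (p ^ n : ℕ)) →
    ¬ p ∣ W.tamagawaProduct →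
    W.entireLFunction 1 ≠ 0 → Finite W.sha →
    ∀ {N : ℕ} [NeZero N] (D : ModularParametrizationData W N),
    ¬ (p : ℤ) ∣ D.maninConstant →
    ∀ (S : Finset ℕ) (d : ℕ → ℕ),
    (∀ (ℓ : ℕ) [Fact ℓ.Prime], W.HasMultiplicativeReductionAtPrime ℓ →
      ℓ ∈ S ∧ (W.HasSplitMultiplicativeReductionAtPrime ℓ → padicValNat p (ℓ - 1) ≤ d ℓ) ∧
        (¬ W.HasSplitMultiplicativeReductionAtPrime ℓ → padicValNat p (ℓ + 1) ≤ d ℓ)) →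
    ∃ q : ℚ, W.entireLFunction 1 / (W.realPeriodRat : ℂ) = (q : ℂ) ∧
      (padicValNat p (Nat.card (AddCommGroup.primaryComponent W.sha p)) : ℤ) ≤
        padicValRat p q + ∑ ℓ ∈ S, (d ℓ : ℤ)

end Literature.NumberTheory.EllipticCurves.KimNakamura2020

end
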